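import Literature.AnabelianGeometry.EtaleTheta.TemperedFrobenioidToyGenuine
import Literature.AnabelianGeometry.EtaleTheta.Discharge.Sec3Thm37RatStdOfLine
import HarnessLib

/-!
# [EtTh] Remark 3.6.2 «`Φ^{bs-fld}` is always non-dilating and strictly rational» — the instance forms the
# tree can prove: print's mechanism (pull-backs fixing the log-divisors of constants), automorphisms on a
# `ℤ`-monoprime / finitely acting `Φ^{bs-fld}`, and the genuine-vocabulary toy

S. Mochizuki, *The étale theta function and its Frobenioid-theoretic manifestations*, Publ. RIMS **45**
(2009) [MochizukiEtTh2009], §3, Remark 3.6.2, PDF p. 78 (printed 304): "`Φ^{bs-fld}` is always non-dilating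
and strictly rational" [cite: MochizukiEtTh2009, Rmk 3.6.2 p.78]; [FrdI] Def. 1.1 (i) (non-dilating
endomorphisms) [cite: MochizukiFrdI2008, Def. 1.1 (i) p.19].

PROOF-ONLY companion (theorems only; no `def`, no `Prop` fact, no frozen file edited) of abc-iut-L2-t3's
statements file `TemperedFrobenioidProps.lean`; abc-iut cell, block F (FACT-LIST fact-proving wave), seat
abc-iut-f-138 (tranche 138), row **F-1311** `TemperedFrobenioid.Remark362` =
`VD.IsStrictlyRational C₀.bsFldMonoid ∧ ∀ A (f : A ⟶ A), V.IsNonDilating _ (C₀.bsFld.pull f)` (class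
`preparatory`, `parametrised`).  STATUS OF THE ROW (R5, named instances only): the universal closure is
REFUTED over arbitrary vocabularies (abc-iut-f-049, `TemperedFrobenioid.not_forall_remark362`: conjunct 1 is
the free [FrdI] Def. 4.5 (ii) stub) AND over the tree's canonical vocabularies (this seat,
`TemperedFrobenioidToyDilatingGenuine.lean`: conjunct 2 fails for the real `Frobenioids.IsNonDilating` — a base
automorphism may SQUARE `Φ^{bs-fld}`, because the typed Def. 3.6 (i) interface records `ℝ·Φ₀^cnst` only as
pull-back STABLE, not pull-back FIXED).  What print actually uses (p. 78 with Prop. 3.4 (ii) p. 74 and the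
discussion preceding Def. 3.3, p. 72: the log-divisors of constants `ℝ·Φ₀^cnst(Y) = ℝ·div(ϖ)` are pulled back
IDENTICALLY along morphisms of tempered coverings) is made an explicit, print-quoting hypothesis here — the
interface-level binder genre of the [EtTh] Thm. 3.7 sub-DAG's `hKfix`/`hLine` (GAP-LEDGER G-w5d250-1,
G-w5d124-2) — and conjunct 2 is DERIVED from it for every tempered Frobenioid:

* `isNonDilating_bsFld_pull_of_forall_pull_eq` — a pull-back acting trivially on `Φ^{bs-fld}(A)` is
  non-dilating ([FrdI] Def. 1.1 (i): `id^char = id`);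
* `bsFld_pull_eq_self_of_cnstR_fixed`, **`isNonDilating_bsFld_pull_of_cnstR_fixed`** — PRINT'S MECHANISM:
  if the pull-back along `f` fixes `ℝ·Φ₀^cnst(Y_A)` pointwise in `(Φ^{ℝ-log})^gp(A)` and `Φ^{ℝ-log}(A)` is
  cancellative ([FrdI] Def. 2.4 (i)(c); a THEOREM at every constructed datum `ofRlfZ`,
  `IsPerfFactorial.Rlf.isCancelMul`), then `f^*` is the identity on `Φ^{bs-fld}(A) = Φ(A) ∩ ℝ·Φ₀^cnst`, hence
  non-dilating;
* **`remark362_of_cnstR_fixed`** / **`remark362_ofRlfZ_of_cnstR_fixed`** — `Remark362 C₀` for every tempered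
  Frobenioid over `treeMonoidVocab` (resp. over the constructed Def. 3.6 (i) data `ofRlfZ dm hpf`) from
  {`hS` : "`Φ^{bs-fld}` strictly rational" BY NAME (the [FrdI] Def. 4.5 (ii) predicate is still a free
  parameter of `treeCatVocab`, abc-iut-L1-t3), `hcnst` : constants pulled back identically (+ `hInt`,
  discharged at `ofRlfZ`)};
* `isNonDilating_bsFld_pull_iso_of_isZMonoprime`, `isNonDilating_bsFld_pull_iso_of_iterate_eq` —
  UNCONDITIONAL along AUTOMORPHISMS of `A` when `Φ^{bs-fld}(A)` is `ℤ`-monoprime (`Aut(ℤ_{≥0}) = 1`), resp.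
  when the induced automorphism of `Φ^{bs-fld}(A)` has finite order (abc-iut-w5-d250's
  `pull_bsFld_eq_self_of_isZMonoprime` / `_of_iterate_eq`, `Sec3Thm37RatStdOfLine.lean`, consumed BY NAME);
* `Toy.remark362_genuineTemperedFrobenioid` — `Remark362` HOLDS at abc-iut-w5-d164's genuine-vocabulary toy
  `Toy.genuineTemperedFrobenioid R S` (`TemperedFrobenioidToyGenuine.lean`; one-object base, every base
  endomorphism an identity) given `hS`; `…_top` at the trivial reading of the Def. 4.5 (ii) parameter
  (HOLDS-AT-TOY; consistency evidence only).

HONEST FRAMING: refereed pre-IUT material ([FrdI] 2008, [EtTh] 2009); the print instance of Remark 3.6.2 needs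
the geometric Def. 3.3 (iii) data (abc-iut-L3-t2's tower of tempered coverings), not in the tree — until then
`hcnst` is a hypothesis quoting print, not a proved fact; nothing here bears on [IUTchIII] Cor. 3.12; no side
taken; a FACT row is an assumption label, "proved" = this kernel check only.
-/

namespace Literature.AnabelianGeometry.EtaleTheta

open CategoryTheory Opposite Literature.AlgebraicGeometry.Frobenioids

universe u₀ v₀ u v w

namespace TemperedFrobenioid

section General

variable {D₀ : Type u₀} [Category.{v₀} D₀] {V : FrdIMonoidStub.{w}}
  {T : RealifiedDivisorMonoids (D₀ := D₀) V} {D : Type u} [Category.{v} D]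
  {VD : FrdICatStub.{u, v, w} D} (C : TemperedFrobenioid T D VD)

/-- A pull-back that acts trivially on `Φ^{bs-fld}(A)` is non-dilating there ([FrdI] Def. 1.1 (i): the
conclusion "`α^char = id`" holds outright for `α = id`). [cite: MochizukiFrdI2008, Def. 1.1 (i) p.19] -/
theorem isNonDilating_bsFld_pull_of_forall_pull_eq {A : Dᵒᵖ} (f : A ⟶ A)
    (hfix : ∀ x : C.bsFld.carrier A, C.bsFld.pull f x = x) : IsNonDilating (C.bsFld.pull f) := by
  have h : C.bsFld.pull f = MonoidHom.id _ := MonoidHom.ext hfix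
  rw [h]
  exact Example39NV.isNonDilating_id

/-- **Print's mechanism for Remark 3.6.2** (p. 78; Prop. 3.4 (ii) p. 74: the log-divisors of constants are
`ℝ·div(ϖ)`, pulled back identically along morphisms of tempered coverings): if the pull-back along
`f : A → A` FIXES `ℝ·Φ₀^cnst(Y_A)` pointwise inside `(Φ^{ℝ-log})^gp(A)` and `Φ^{ℝ-log}(A)` is cancellative
(so that `Φ^{ℝ-log}(A) → (Φ^{ℝ-log})^gp(A)` is injective, [FrdI] Def. 2.4 (i)(c)), then `f^*` is the
identity on `Φ^{bs-fld}(A) = Φ(A) ×_{(Φ^{ℝ-log})^gp} ℝ·Φ₀^cnst`. [cite: MochizukiEtTh2009, Rmk 3.6.2 p.78] -/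
theorem bsFld_pull_eq_self_of_cnstR_fixed {A : Dᵒᵖ} (f : A ⟶ A) [IsCancelMul (C.ΦRlog.obj A)]
    (hcnst : ∀ g ∈ T.cnstR (C.baseOp A), gpMap (C.ΦRlog.map f).hom g = g)
    (x : C.bsFld.carrier A) : C.bsFld.pull f x = x := by
  apply Subtype.ext
  rw [SubMonoidOn.coe_pull]
  apply Algebra.GrothendieckGroup.of_injective
  rw [← gpMap_of]
  exact hcnst _ x.2.2

/-- **Remark 3.6.2, conjunct 2, from print's mechanism**: under the hypotheses of
`bsFld_pull_eq_self_of_cnstR_fixed`, the pull-back of `Φ^{bs-fld}` along `f` is non-dilating (it is the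
identity). [cite: MochizukiEtTh2009, Rmk 3.6.2 p.78] -/
theorem isNonDilating_bsFld_pull_of_cnstR_fixed {A : Dᵒᵖ} (f : A ⟶ A) [IsCancelMul (C.ΦRlog.obj A)]
    (hcnst : ∀ g ∈ T.cnstR (C.baseOp A), gpMap (C.ΦRlog.map f).hom g = g) :
    IsNonDilating (C.bsFld.pull f) :=
  C.isNonDilating_bsFld_pull_of_forall_pull_eq f (C.bsFld_pull_eq_self_of_cnstR_fixed f hcnst)

/-- **Unconditionally along automorphisms when `Φ^{bs-fld}(A)` is `ℤ`-monoprime**: the pull-back along an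
AUTOMORPHISM `f` of `A` induces an automorphism of `Φ^{bs-fld}(A) ≅ ℤ_{≥0}`, necessarily the identity
(`Aut(ℤ_{≥0}) = 1`; abc-iut-w5-d250's `pull_bsFld_eq_self_of_isZMonoprime`), so it is non-dilating.
[cite: MochizukiEtTh2009, Rmk 3.6.2 p.78] -/
theorem isNonDilating_bsFld_pull_iso_of_isZMonoprime (A : D) (hZ : IsZMonoprime (C.bsFld.carrier (op A)))
    (f : A ≅ A) : IsNonDilating (C.bsFld.pull f.hom.op) :=
  C.isNonDilating_bsFld_pull_of_forall_pull_eq f.hom.op fun x => by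
    have h := congrArg Subtype.val (C.pull_bsFld_eq_self_of_isZMonoprime A hZ f ⟨x.1, x.2.1⟩ x.2)
    exact Subtype.ext h

/-- **Unconditionally along automorphisms acting with finite order on `Φ^{bs-fld}(A)`** (any monoprime type —
e.g. when `Aut_D(A)` acts on `Φ^{bs-fld}(A)` through a finite group): a finite-order automorphism of the
monoprime `Φ^{bs-fld}(A)` is the identity (abc-iut-w5-d250's `pull_bsFld_eq_self_of_iterate_eq`), hence
non-dilating. [cite: MochizukiEtTh2009, Rmk 3.6.2 p.78] -/
theorem isNonDilating_bsFld_pull_iso_of_iterate_eq (A : D) (f : A ≅ A) {n : ℕ} (hn : 0 < n)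
    (hper : ∀ x : C.bsFld.carrier (op A), (C.bsFld.pull f.hom.op)^[n] x = x) :
    IsNonDilating (C.bsFld.pull f.hom.op) :=
  C.isNonDilating_bsFld_pull_of_forall_pull_eq f.hom.op fun x => by
    have h := congrArg Subtype.val (C.pull_bsFld_eq_self_of_iterate_eq A f hn hper ⟨x.1, x.2.1⟩ x.2)
    exact Subtype.ext h

end General

/-! ### `Remark362` over the tree's monoid vocabulary -/

section TreeVocab

variable {D₀ : Type u₀} [Category.{v₀} D₀] {T : RealifiedDivisorMonoids (D₀ := D₀) treeMonoidVocab.{w}}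
  {D : Type u} [Category.{v} D] {VD : FrdICatStub.{u, v, w} D} (C : TemperedFrobenioid T D VD)

/-- **Remark 3.6.2 for a tempered Frobenioid over the tree's monoid vocabulary, from print's inputs BY NAME**:
`hS` — "`Φ^{bs-fld}` is strictly rational" ([FrdI] Def. 4.5 (ii); the predicate is still the free parameter
`VD.IsStrictlyRational` of the category vocabulary); `hInt` — each `Φ^{ℝ-log}(A)` cancellative ([FrdI]
Def. 2.4 (i)(c)); `hcnst` — pull-backs along base endomorphisms fix the log-divisors of constants
`ℝ·Φ₀^cnst(Y_A)` (Prop. 3.4 (ii) / p. 72).  Then `Remark362 C₀` (conjunct 2 DERIVED, read through the real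
`Frobenioids.IsNonDilating`). [cite: MochizukiEtTh2009, Rmk 3.6.2 p.78] -/
theorem remark362_of_cnstR_fixed (hS : VD.IsStrictlyRational C.bsFldMonoid)
    (hInt : ∀ A : Dᵒᵖ, IsCancelMul (C.ΦRlog.obj A))
    (hcnst : ∀ (A : Dᵒᵖ) (f : A ⟶ A) (g : Algebra.GrothendieckGroup (C.ΦRlog.obj A)),
      g ∈ T.cnstR (C.baseOp A) → gpMap (C.ΦRlog.map f).hom g = g) :
    C.Remark362 := by
  refine ⟨hS, fun A f => ?_⟩
  haveI := hInt A
  exact (treeMonoidVocab_isNonDilating _ _).mpr (C.isNonDilating_bsFld_pull_of_cnstR_fixed f (hcnst A f))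

end TreeVocab

/-! ### `Remark362` over the CONSTRUCTED Def. 3.6 (i) data `ofRlfZ` (`hInt` discharged) -/

section OfRlfZ

variable {D₀ : Type u₀} [Category.{v₀} D₀] (dm : DivisorMonoids.{u₀, v₀, w} D₀)
  (hpf : ∀ Y : D₀ᵒᵖ, IsPerfFactorial (dm.Φ₀.obj Y))
  {D : Type u} [Category.{v} D] {VD : FrdICatStub.{u, v, w} D}
  (C : TemperedFrobenioid (RealifiedDivisorMonoids.ofRlfZ dm hpf) D VD)

/-- **Remark 3.6.2 at the constructed monoid-type-`ℤ` data** (abc-iut-L6-t12's `ofRlfZ dm hpf`: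
`Φ₀^ℝ = Φ₀^rlf` the real realification, cancellative by `IsPerfFactorial.Rlf.isCancelMul`) from `hS` and
`hcnst` only. [cite: MochizukiEtTh2009, Rmk 3.6.2 p.78] -/
theorem remark362_ofRlfZ_of_cnstR_fixed (hS : VD.IsStrictlyRational C.bsFldMonoid)
    (hcnst : ∀ (A : Dᵒᵖ) (f : A ⟶ A) (g : Algebra.GrothendieckGroup (C.ΦRlog.obj A)),
      g ∈ (RealifiedDivisorMonoids.ofRlfZ dm hpf).cnstR (C.baseOp A) → gpMap (C.ΦRlog.map f).hom g = g) :
    C.Remark362 :=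
  C.remark362_of_cnstR_fixed hS (fun A => IsPerfFactorial.Rlf.isCancelMul (hpf (C.baseOp A))) hcnst

end OfRlfZ

end TemperedFrobenioid

/-! ### `Remark362` HOLDS at the genuine-vocabulary toy -/

namespace Toy

variable (R S : ((Discrete PUnit.{1})ᵒᵖ ⥤ CommMonCat.{0}) → Prop)

/-- **Remark 3.6.2 at abc-iut-w5-d164's genuine-vocabulary toy** `Toy.genuineTemperedFrobenioid R S`
(`Φ := im(Φ₀^pf → Φ₀^rlf)` over `ofRlfZ Toy.divisorMonoids` on the one-object base, `treeMonoidVocab` /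
`treeCatVocab _ R S`): conjunct 2 HOLDS because every base endomorphism is an identity (so every pull-back of
`Φ^{bs-fld}` is the identity, non-dilating for the real `Frobenioids.IsNonDilating`); conjunct 1 is the free
Def. 4.5 (ii) parameter `S`, assumed BY NAME.  A consistency witness (HOLDS-AT-TOY), not the tempered
Frobenioid of a curve. [cite: MochizukiEtTh2009, Rmk 3.6.2 p.78] -/
theorem remark362_genuineTemperedFrobenioid (hS : S (genuineTemperedFrobenioid R S).bsFldMonoid) :
    (genuineTemperedFrobenioid R S).Remark362 := by
  refine ⟨hS, fun A f => ?_⟩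
  have hf : f = 𝟙 A := Quiver.Hom.unop_inj (Subsingleton.elim _ _)
  subst hf
  rw [treeMonoidVocab_isNonDilating]
  have hpull : (genuineTemperedFrobenioid R S).bsFld.pull (𝟙 A) = MonoidHom.id _ := by
    ext x
    rw [SubMonoidOn.coe_pull, CategoryTheory.Functor.map_id, MonoidHom.id_apply]
    rfl
  rw [hpull]
  exact Example39NV.isNonDilating_id

/-- The same at the trivial reading `⊤` of the (still free) [FrdI] Def. 4.5 (ii) parameter "strictly
rational": `Remark362` holds outright at the genuine toy — the typed row is satisfiable over the tree's
canonical monoid vocabulary (complementing `DilatingToyGenuine.not_remark362`: it is not valid there).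
[cite: MochizukiEtTh2009, Rmk 3.6.2 p.78] -/
theorem remark362_genuineTemperedFrobenioid_top :
    (genuineTemperedFrobenioid R fun _ => True).Remark362 :=
  remark362_genuineTemperedFrobenioid R _ trivial

end Toy

end Literature.AnabelianGeometry.EtaleTheta
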